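import Mathlib
import Literature.Analysis.FluidPDE.VectorCalculus
import Literature.Analysis.FluidPDE.VorticityStretching
import Summits.NavierStokesRegularity.NavierStokesRegularity.Theorems.ThreadingFluxErtelTowerKinematicRigidity
import HarnessLib

/-!
# Crux `PoloidalLiouville` (stmt-NavierStokesRegularity-1222, W1), crux idea «radial-jerk-tower» (ns-idea-15 g7):
# THE VORTICITY OF A LOCAL EULER SOLUTION IS A FROZEN FIELD

Support file (`--supports stmt-NavierStokesRegularity-1222`, helper).  Experiment cell `ns-wall-extremal`, width hand
ns-wall-eng-5 g6, director KEY-NS #186 («V21 radial-jerk-tower sizes go to eng-5 g6»); critic of record ns-wall-crit-1 g4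
(V21 PASS-WITH-PRICE).  0 kit.

The bridge from the sketch's EULER hypotheses (`Cruxes/PoloidalLiouville/ErtelTowerSketch.lean` v1.1 Part B: `(v, p)` jointly
smooth on an open `I × U`, `∂ₜv + Dv[v] + ∇p = 0`, `div v = 0`) to the FROZEN-FIELD hypotheses of
`ThreadingFluxErtelTowerKinematicRigidity` (`B` jointly smooth, `∂ₜB + DB[u] − Du[B] = 0`), with `u = v`, `B = ω = curl v`:

* local curl calculus at a point of class `C²`: `fderiv_curl_of_contDiffAt` (`D(curl v) = curlCLM ∘ D²v`),
  `curl_convect_self_of_contDiffAt` (`curl((v·∇)v) = Dω[v] − Dv[ω] + (div v) ω`, from the tree's `curlCLM_comp_self`;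
  local form of `Literature.Analysis.FluidPDE.curl_convect_self`), `curl_gradient_of_contDiffAt` (`curl ∇φ = 0`);
* `curl_eq_curlCLM_uncurry`, `contDiffOn_curl_uncurry` — the vorticity of a jointly smooth field in terms of the joint
  derivative; it is jointly smooth on `I × U`;
* ★ `vorticity_transport` — **the vorticity equation with forcing**: if `∂ₜv + Dv[v] + ∇p = f` on `I × U` (Euler: `f = 0`;
  Navier–Stokes: `f t = Δ(v t)`), then `∂ₜω + Dω[v] − Dv[ω] = curl (f t)` on `I × U` (curl of the momentum equation on the
  open set `U`; `curl ∂ₜv = ∂ₜ curl v` by the symmetry of `D²(uncurry v)`; the stretching term from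
  `curl_convect_self_of_contDiffAt` and `div v = 0`; `curl ∇p = 0`);
* ★ `vorticity_frozen` — **Euler ⇒ ω is frozen**: `∂ₜω + Dω[v] − Dv[ω] = 0` on `I × U`.

BOOKING (critic's words, V21): the classical vorticity equation (Helmholtz/Kelvin) in a region, typed for the lineage; a
statement about EULER, NO W1 movement by itself, refutes nothing.  Consumed by `ThreadingFluxErtelTowerEulerTower` (the four
inviscid sketch Props by name) and by the viscous level-two law (forcing `f = Δv`).  `PoloidalLiouville` (1222) and (27585) are OPEN; NS regularity is NOT proved.
-/

-- the summit and its single problem share the name (D-0017 nested layout)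
set_option linter.dupNamespace false

noncomputable section

namespace Summit.NavierStokesRegularity.NavierStokesRegularity.Theorems.PoloidalLiouville.ErtelTower

open Set Function Filter Topology Metric
open scoped Topology RealInnerProductSpace InnerProductSpace
open Literature.Analysis.FluidPDE
open Summit.NavierStokesRegularity.NavierStokesRegularity.Theorems.PoloidalLiouville.HorizonTower (E3)

/-! ### Local curl calculus -/

section LocalCurl

variable {v : E3 → E3} {x : E3}

/-- Chain rule for the curl at a point: `D(curl v)(x) = curlCLM ∘ D(Dv)(x)` for `v` of class `C²` at `x`
(local form of `Literature.Analysis.FluidPDE.fderiv_curl`). -/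
theorem fderiv_curl_of_contDiffAt (hv : ContDiffAt ℝ 2 v x) :
    fderiv ℝ (curl v) x = curlCLM.comp (fderiv ℝ (fderiv ℝ v) x) := by
  rw [curl_eq_curlCLM_comp]
  have hd : DifferentiableAt ℝ (fderiv ℝ v) x := (hv.fderiv_right (m := 1) (by norm_num)).differentiableAt (by simp)
  exact (curlCLM.hasFDerivAt.comp x hd.hasFDerivAt).fderiv

/-- Local form of `curl_convect_self`: `curl((v·∇)v)(x) = (v·∇)ω − (ω·∇)v + (div v) ω` at a point where `v` is `C²`. -/
theorem curl_convect_self_of_contDiffAt (hv : ContDiffAt ℝ 2 v x) :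
    curl (fun y => fderiv ℝ v y (v y)) x
      = fderiv ℝ (curl v) x (v x) - fderiv ℝ v x (curl v x) + VectorCalculus.divergence v x • curl v x := by
  have hD : HasFDerivAt (fderiv ℝ v) (fderiv ℝ (fderiv ℝ v) x) x :=
    ((hv.fderiv_right (m := 1) (by norm_num)).differentiableAt (by simp)).hasFDerivAt
  have hvx : HasFDerivAt v (fderiv ℝ v x) x := (hv.differentiableAt (by norm_num)).hasFDerivAt
  have hconv : HasFDerivAt (fun y => fderiv ℝ v y (v y))
      ((fderiv ℝ v x).comp (fderiv ℝ v x) + (fderiv ℝ (fderiv ℝ v) x).flip (v x)) x := hD.clm_apply hvx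
  have hsymm : (fderiv ℝ (fderiv ℝ v) x).flip (v x) = fderiv ℝ (fderiv ℝ v) x (v x) := by
    ext k i
    rw [ContinuousLinearMap.flip_apply]
    exact congrFun (congrArg _ ((hv.isSymmSndFDerivAt (by simp)) k (v x))) i
  rw [curl_eq_curlCLM, hconv.fderiv, map_add, curlCLM_comp_self, hsymm, fderiv_curl_of_contDiffAt hv]
  simp only [ContinuousLinearMap.comp_apply, ← curl_eq_curlCLM]
  have h3 : LinearMap.trace ℝ E3 (fderiv ℝ v x : E3 →ₗ[ℝ] E3) = VectorCalculus.divergence v x := rfl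
  rw [h3]
  abel

/-- Local form of `curl ∇φ = 0`: at a point where `φ` is `C²`. -/
theorem curl_gradient_of_contDiffAt {φ : E3 → ℝ} (hφ : ContDiffAt ℝ 2 φ x) : curl (gradient φ) x = 0 := by
  have hsymm : IsSymmSndFDerivAt ℝ φ x := hφ.isSymmSndFDerivAt (by simp)
  have hD : DifferentiableAt ℝ (fderiv ℝ φ) x := (hφ.fderiv_right (m := 1) (by norm_num)).differentiableAt (by simp)
  have hgrad : HasFDerivAt (gradient φ)
      (((InnerProductSpace.toDual ℝ E3).symm : (E3 →L[ℝ] ℝ) →L[ℝ] E3).comp (fderiv ℝ (fderiv ℝ φ) x)) x :=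
    ((InnerProductSpace.toDual ℝ E3).symm.toContinuousLinearEquiv.toContinuousLinearMap.hasFDerivAt).comp x
      hD.hasFDerivAt
  have hS : ∀ i j : Fin 3, fderiv ℝ (gradient φ) x (EuclideanSpace.single j 1) i =
      fderiv ℝ (fderiv ℝ φ) x (EuclideanSpace.single j 1) (EuclideanSpace.single i 1) := by
    intro i j
    rw [hgrad.fderiv, ContinuousLinearMap.comp_apply]
    show ((InnerProductSpace.toDual ℝ E3).symm (fderiv ℝ (fderiv ℝ φ) x (EuclideanSpace.single j 1))) i = _
    have h := InnerProductSpace.toDual_symm_apply (𝕜 := ℝ) (E := E3)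
      (x := EuclideanSpace.single i 1) (y := fderiv ℝ (fderiv ℝ φ) x (EuclideanSpace.single j 1))
    rw [EuclideanSpace.inner_single_right] at h
    simpa using h
  have hS' : ∀ i j : Fin 3, fderiv ℝ (gradient φ) x (EuclideanSpace.single j 1) i
      = fderiv ℝ (gradient φ) x (EuclideanSpace.single i 1) j := by
    intro i j; rw [hS, hS, hsymm.eq]
  simp only [curl]
  rw [hS' 2 1, hS' 0 2, hS' 1 0, sub_self, sub_self, sub_self]
  ext k
  fin_cases k <;> simp

end LocalCurl

/-! ### The vorticity of a local Euler solution is a frozen field -/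

section Euler

variable {v : ℝ → E3 → E3} {p : ℝ → E3 → ℝ} {I : Set ℝ} {U : Set E3}

/-- The vorticity `ω(t,x) = curl (v t) x` of a jointly smooth field in terms of the joint derivative. -/
theorem curl_eq_curlCLM_uncurry (hv : ContDiffOn ℝ (⊤ : ℕ∞) (Function.uncurry v) (I ×ˢ U))
    (hI : IsOpen I) (hU : IsOpen U) {t : ℝ} {x : E3} (ht : t ∈ I) (hx : x ∈ U) :
    curl (v t) x = curlCLM ((fderiv ℝ (Function.uncurry v) (t, x)).comp (ContinuousLinearMap.inr ℝ ℝ E3)) := by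
  have hd : DifferentiableAt ℝ (Function.uncurry v) (t, x) :=
    (contDiffAt_of_contDiffOn_prod hv hI hU ht hx).differentiableAt (by simp)
  have h1 : HasFDerivAt (fun w : E3 => (t, w)) (ContinuousLinearMap.inr ℝ ℝ E3) x :=
    (hasFDerivAt_const t x).prodMk (hasFDerivAt_id x)
  have hslice : HasFDerivAt (v t) ((fderiv ℝ (Function.uncurry v) (t, x)).comp (ContinuousLinearMap.inr ℝ ℝ E3)) x :=
    hd.hasFDerivAt.comp x h1
  rw [curl_eq_curlCLM, hslice.fderiv]

/-- **The vorticity of a jointly smooth field is jointly smooth** on `I × U`. -/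
theorem contDiffOn_curl_uncurry (hv : ContDiffOn ℝ (⊤ : ℕ∞) (Function.uncurry v) (I ×ˢ U))
    (hI : IsOpen I) (hU : IsOpen U) :
    ContDiffOn ℝ (⊤ : ℕ∞) (Function.uncurry fun t x => curl (v t) x) (I ×ˢ U) := by
  have hopen : IsOpen (I ×ˢ U) := hI.prod hU
  have hD : ContDiffOn ℝ (⊤ : ℕ∞) (fderiv ℝ (Function.uncurry v)) (I ×ˢ U) := hv.fderiv_of_isOpen hopen le_rfl
  have hrhs : ContDiffOn ℝ (⊤ : ℕ∞)
      (fun q : ℝ × E3 => curlCLM ((fderiv ℝ (Function.uncurry v) q).comp (ContinuousLinearMap.inr ℝ ℝ E3))) (I ×ˢ U) := by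
    have hcomp : ContDiffOn ℝ (⊤ : ℕ∞)
        (fun q : ℝ × E3 => (fderiv ℝ (Function.uncurry v) q).comp (ContinuousLinearMap.inr ℝ ℝ E3)) (I ×ˢ U) :=
      hD.clm_comp contDiffOn_const
    exact curlCLM.contDiff.comp_contDiffOn hcomp
  refine hrhs.congr fun q hq => ?_
  obtain ⟨t, x⟩ := q
  exact curl_eq_curlCLM_uncurry hv hI hU hq.1 hq.2

/-- **THE VORTICITY EQUATION WITH FORCING** (local, pointwise): for a jointly smooth incompressible field `v` and a
jointly smooth `p` on the open `I × U` with momentum residual `f` (`∂ₜv + Dv[v] + ∇p = f` on `I × U`; for Euler `f = 0`,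
for Navier–Stokes `f t = Δ(v t)`), the vorticity `ω = curl v` satisfies `∂ₜω + Dω[v] − Dv[ω] = curl (f t)` on `I × U`.
Proof: the momentum equation holds on the open set `U` at each time, so the curls of its two sides agree at `x`;
`curl ∂ₜv = ∂ₜ curl v` (symmetry of the mixed second derivative of `uncurry v`), `curl((v·∇)v) = Dω[v] − Dv[ω]`
(div-free, local `curl_convect_self`), `curl ∇p = 0`. -/
theorem vorticity_transport {f : ℝ → E3 → E3} (hI : IsOpen I) (hU : IsOpen U)
    (hv : ContDiffOn ℝ (⊤ : ℕ∞) (Function.uncurry v) (I ×ˢ U))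
    (hp : ContDiffOn ℝ (⊤ : ℕ∞) (Function.uncurry p) (I ×ˢ U))
    (hmom : ∀ t ∈ I, ∀ x ∈ U, deriv (fun s => v s x) t + fderiv ℝ (v t) x (v t x) + gradient (p t) x = f t x)
    (hdiv : ∀ t ∈ I, ∀ x ∈ U, Literature.Analysis.FluidPDE.VectorCalculus.divergence (v t) x = 0) :
    ∀ t ∈ I, ∀ x ∈ U,
      deriv (fun s => curl (v s) x) t + fderiv ℝ (curl (v t)) x (v t x) - fderiv ℝ (v t) x (curl (v t) x)
        = curl (f t) x := by
  intro t ht x hx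
  set V := Function.uncurry v with hVdef
  have hopen : IsOpen (I ×ˢ U) := hI.prod hU
  have hVat : ContDiffAt ℝ (⊤ : ℕ∞) V (t, x) := contDiffAt_of_contDiffOn_prod hv hI hU ht hx
  have hpat : ContDiffAt ℝ (⊤ : ℕ∞) (Function.uncurry p) (t, x) := contDiffAt_of_contDiffOn_prod hp hI hU ht hx
  have hDV : ContDiffAt ℝ (⊤ : ℕ∞) (fderiv ℝ V) (t, x) := hVat.fderiv_right (m := (⊤ : ℕ∞)) (by exact_mod_cast le_top)
  have hDVd : DifferentiableAt ℝ (fderiv ℝ V) (t, x) := hDV.differentiableAt (by simp)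
  -- the slices `v t` and `p t` are `C²` (indeed smooth) near `x`
  have hinr : ∀ z : E3, HasFDerivAt (fun w : E3 => (t, w)) (ContinuousLinearMap.inr ℝ ℝ E3) z := fun z =>
    (hasFDerivAt_const t z).prodMk (hasFDerivAt_id z)
  have hvt2 : ContDiffAt ℝ 2 (v t) x := by
    have h : ContDiffAt ℝ 2 (V ∘ fun w : E3 => (t, w)) x :=
      (hVat.of_le (by norm_cast)).comp x (contDiffAt_const.prodMk contDiffAt_id)
    exact h
  have hpt2 : ContDiffAt ℝ 2 (p t) x := by
    have h : ContDiffAt ℝ 2 (Function.uncurry p ∘ fun w : E3 => (t, w)) x :=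
      (hpat.of_le (by norm_cast)).comp x (contDiffAt_const.prodMk contDiffAt_id)
    exact h
  -- (1) the time derivative of the vorticity: `∂ₜ ω = curlCLM (D²V(t,x)[(1,0)] ∘ inr)`
  have hω_near : ∀ s ∈ I, curl (v s) x = curlCLM ((fderiv ℝ V (s, x)).comp (ContinuousLinearMap.inr ℝ ℝ E3)) :=
    fun s hs => curl_eq_curlCLM_uncurry hv hI hU hs hx
  have hωt : HasDerivAt (fun s => curl (v s) x)
      (curlCLM ((fderiv ℝ (fderiv ℝ V) (t, x) ((1 : ℝ), (0 : E3))).comp (ContinuousLinearMap.inr ℝ ℝ E3))) t := by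
    have hev : (fun s => curl (v s) x) =ᶠ[𝓝 t]
        fun s => curlCLM ((fderiv ℝ V (s, x)).comp (ContinuousLinearMap.inr ℝ ℝ E3)) := by
      filter_upwards [hI.mem_nhds ht] with s hs using hω_near s hs
    refine HasDerivAt.congr_of_eventuallyEq ?_ hev
    have h1 : HasDerivAt (fun s : ℝ => (s, x)) (1, 0) t := (hasDerivAt_id t).prodMk (hasDerivAt_const t x)
    have h2 : HasDerivAt (fun s : ℝ => fderiv ℝ V (s, x)) (fderiv ℝ (fderiv ℝ V) (t, x) ((1 : ℝ), (0 : E3))) t :=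
      hDVd.hasFDerivAt.comp_hasDerivAt t h1
    have h3 : HasDerivAt (fun s : ℝ => (fderiv ℝ V (s, x)).comp (ContinuousLinearMap.inr ℝ ℝ E3))
        ((fderiv ℝ (fderiv ℝ V) (t, x) ((1 : ℝ), (0 : E3))).comp (ContinuousLinearMap.inr ℝ ℝ E3)) t :=
      ((ContinuousLinearMap.compL ℝ E3 (ℝ × E3) E3).flip (ContinuousLinearMap.inr ℝ ℝ E3)).hasFDerivAt.comp_hasDerivAt t h2
    exact curlCLM.hasFDerivAt.comp_hasDerivAt t h3
  -- (2) the x-derivative of `x ↦ ∂ₜv(t,x) = DV(t,x)[(1,0)]`, its curl, and symmetry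
  have hE : ∀ z ∈ U, deriv (fun s => v s z) t = fderiv ℝ V (t, z) ((1 : ℝ), (0 : E3)) := by
    intro z hz
    have hd : DifferentiableAt ℝ V (t, z) :=
      (contDiffAt_of_contDiffOn_prod hv hI hU ht hz).differentiableAt (by simp)
    have h1 : HasDerivAt (fun s : ℝ => (s, z)) (1, 0) t := (hasDerivAt_id t).prodMk (hasDerivAt_const t z)
    exact (hd.hasFDerivAt.comp_hasDerivAt t h1).deriv
  have hcurl_dt : curl (fun z => deriv (fun s => v s z) t) x
      = curlCLM ((fderiv ℝ (fderiv ℝ V) (t, x) ((1 : ℝ), (0 : E3))).comp (ContinuousLinearMap.inr ℝ ℝ E3)) := by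
    have hev : (fun z => deriv (fun s => v s z) t) =ᶠ[𝓝 x] fun z => fderiv ℝ V (t, z) ((1 : ℝ), (0 : E3)) := by
      filter_upwards [hU.mem_nhds hx] with z hz using hE z hz
    rw [curl_eq_curlCLM, hev.fderiv_eq]
    have hc : HasFDerivAt (fun z : E3 => fderiv ℝ V (t, z)) ((fderiv ℝ (fderiv ℝ V) (t, x)).comp (ContinuousLinearMap.inr ℝ ℝ E3)) x :=
      hDVd.hasFDerivAt.comp x (hinr x)
    have happ : HasFDerivAt (fun z : E3 => fderiv ℝ V (t, z) ((1 : ℝ), (0 : E3)))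
        (((fderiv ℝ (fderiv ℝ V) (t, x)).comp (ContinuousLinearMap.inr ℝ ℝ E3)).flip ((1 : ℝ), (0 : E3))) x := by
      have := hc.clm_apply (hasFDerivAt_const ((1 : ℝ), (0 : E3)) x)
      simpa using this
    rw [happ.fderiv]
    congr 1
    ext h i
    simp only [ContinuousLinearMap.flip_apply, ContinuousLinearMap.comp_apply, ContinuousLinearMap.inr_apply]
    -- symmetry of `D²V(t,x)`
    have hs := (hVat.isSymmSndFDerivAt (by
      rw [minSmoothness_of_isRCLikeNormedField]; exact WithTop.coe_le_coe.mpr le_top)) ((0 : ℝ), h) ((1 : ℝ), (0 : E3))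
    exact congrFun (congrArg _ hs) i
  -- (3) curl of the momentum equation on the open set `U`
  have hmom0 : curl (fun z => deriv (fun s => v s z) t + fderiv ℝ (v t) z (v t z) + gradient (p t) z) x = curl (f t) x := by
    have hev : (fun z => deriv (fun s => v s z) t + fderiv ℝ (v t) z (v t z) + gradient (p t) z) =ᶠ[𝓝 x] f t := by
      filter_upwards [hU.mem_nhds hx] with z hz using hmom t ht z hz
    rw [curl_eq_curlCLM, hev.fderiv_eq, ← curl_eq_curlCLM]
  -- differentiability of the three terms at `x` (to split the curl of the sum)
  have hd1 : DifferentiableAt ℝ (fun z => deriv (fun s => v s z) t) x := by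
    have hev : (fun z => deriv (fun s => v s z) t) =ᶠ[𝓝 x] fun z => fderiv ℝ V (t, z) ((1 : ℝ), (0 : E3)) := by
      filter_upwards [hU.mem_nhds hx] with z hz using hE z hz
    refine (DifferentiableAt.congr_of_eventuallyEq ?_ hev)
    exact ((hDVd.hasFDerivAt.comp x (hinr x)).clm_apply (hasFDerivAt_const ((1 : ℝ), (0 : E3)) x)).differentiableAt
  have hd2 : DifferentiableAt ℝ (fun z => fderiv ℝ (v t) z (v t z)) x := by
    have hD : DifferentiableAt ℝ (fderiv ℝ (v t)) x := (hvt2.fderiv_right (m := 1) (by norm_num)).differentiableAt (by simp)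
    exact hD.clm_apply (hvt2.differentiableAt (by norm_num))
  have hd3 : DifferentiableAt ℝ (gradient (p t)) x := by
    have hD : DifferentiableAt ℝ (fderiv ℝ (p t)) x := (hpt2.fderiv_right (m := 1) (by norm_num)).differentiableAt (by simp)
    exact ((InnerProductSpace.toDual ℝ E3).symm.differentiableAt).comp x hD
  have hd12 : DifferentiableAt ℝ (fun z => deriv (fun s => v s z) t + fderiv ℝ (v t) z (v t z)) x := hd1.add hd2
  have hsplit : curl (fun z => deriv (fun s => v s z) t + fderiv ℝ (v t) z (v t z) + gradient (p t) z) x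
      = curl (fun z => deriv (fun s => v s z) t) x + curl (fun z => fderiv ℝ (v t) z (v t z)) x + curl (gradient (p t)) x := by
    simp only [curl_eq_curlCLM]
    rw [fderiv_fun_add hd12 hd3, fderiv_fun_add hd1 hd2, map_add, map_add]
  rw [hsplit, curl_gradient_of_contDiffAt hpt2, add_zero, curl_convect_self_of_contDiffAt hvt2,
    hdiv t ht x hx, zero_smul, add_zero, hcurl_dt] at hmom0
  rw [hωt.deriv]
  -- `hmom0 : ∂ₜω + (Dω[v] − Dv[ω]) = curl (f t) x`
  rw [← add_sub_assoc] at hmom0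
  exact hmom0

/-- ★ **Euler ⇒ the vorticity is FROZEN**: for a smooth incompressible Euler solution on the open `I × U`
(`∂ₜv + Dv[v] + ∇p = 0`, `div v = 0`), the vorticity `ω = curl v` satisfies `∂ₜω + Dω[v] − Dv[ω] = 0` there
(`vorticity_transport` with `f = 0`). -/
theorem vorticity_frozen (hI : IsOpen I) (hU : IsOpen U)
    (hv : ContDiffOn ℝ (⊤ : ℕ∞) (Function.uncurry v) (I ×ˢ U))
    (hp : ContDiffOn ℝ (⊤ : ℕ∞) (Function.uncurry p) (I ×ˢ U))
    (heuler : ∀ t ∈ I, ∀ x ∈ U, deriv (fun s => v s x) t + fderiv ℝ (v t) x (v t x) + gradient (p t) x = 0)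
    (hdiv : ∀ t ∈ I, ∀ x ∈ U, Literature.Analysis.FluidPDE.VectorCalculus.divergence (v t) x = 0) :
    ∀ t ∈ I, ∀ x ∈ U,
      deriv (fun s => curl (v s) x) t + fderiv ℝ (curl (v t)) x (v t x) - fderiv ℝ (v t) x (curl (v t) x) = 0 := by
  intro t ht x hx
  have h := vorticity_transport (f := fun _ _ => (0 : E3)) hI hU hv hp heuler hdiv t ht x hx
  rw [h]
  exact curl_fun_zero x

end Euler

end Summit.NavierStokesRegularity.NavierStokesRegularity.Theorems.PoloidalLiouville.ErtelTower
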